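/-
Copyright (c) 2026 the pub-hodgecm-mathlib formalisation cell (harness21).  Prover seat hodgecm-mathlib-F0P3a-p01 (g18): road «S3-ram», (Cnt2′) ROUTE B, the (α) BLOCK-LAW
skeleton (keeper F0P3a-p06 (g16) v2.2; chair F0P3a-p07 (g15) RULINGS (16)(c), (17)): THE REGIME A-ODD ∕ C HYPERBOLIC CELL, ROW `0`, CLOSED; 2026-09-02.
-/
import Literature.NumberTheory.Rogawski1990.DepthZeroKappaTransferTypeTwoRamifiedHyperbolicTotals        -- ★ p849287 (F0P3a-p08 (g20)): `BlockLawHyp.hyperbolicTotal_zero_ram_of_region_census_odd`; brings the CM dictionary imports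
import Literature.NumberTheory.Rogawski1990.DepthZeroKappaTransferTypeTwoRamifiedHyperbolicRootCensus    -- p849494 (this seat): `rootRegionCensus_hyperbolic_odd`; brings ★ p849462, ★ p849383, ★ p849330
import Literature.NumberTheory.Rogawski1990.TypeTwoRamifiedFrameLiteralRootRegion                         -- ★ (A-p19 (g29), (o2′)): `ncard_selfDual_fixed_lev_rerootedCentred_eq_ncard_ball_ram`, `v_det_rerootedCentred_sub_one_eq_ram`, `det_coe_inv_conj_scalar_mul_sub_one`; brings ★ `exists_centre_forall_v_rerootedCentred_sub_one_le_of_odd_ram`, A-p12 ★ `…WSideBalls`, chair ★ `typeTwo_depthDictionary_odd_ram`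
import Literature.NumberTheory.Rogawski1990.DepthZeroKappaTransferTypeTwoRamifiedDepthSign                -- ★ p849319 (chair F0P3a-p07 (g15)): `typeTwo_hilbertSymbol_eq_one_iff_exists_sq_ram`
import Literature.NumberTheory.Automorphic.UnitaryLatticeTreeFramesOfInvolution                             -- ★ `isTree_latticeGraph_three_of_neg`
import Literature.NumberTheory.Automorphic.UnitaryLatticeTreeResidualTokens                                 -- ★ `exists_unit_v_sub_mul_sq_lt_one_iff_residue`; brings ★ `exists_ne_zero_eq_mul_sq_iff_quadraticChar`
import HarnessLib

/-!
# The ramified `κ`-orbital integral, type (2): THE REGIME A-ODD ∕ C HYPERBOLIC CELL OF THE BLOCK-LAW SKELETON, ROW `0` —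
# `#A = 1 + NE·S(E_{mA+1})₀ + P·S(P_{mA})₀`, `(NE, P) = (2q, (q−1)q)` if `(β, θ)_v = 1`, `(0, (q+1)q)` if `(β, θ)_v = −1`
# (Rogawski 1990 §4.9; Kottwitz 1986 §3; Labesse–Langlands 1979 §2; Bruhat–Tits 1972 §10)

Topic `NumberTheory/Rogawski1990`; namespace `Literature.NumberTheory.Rogawski1990.BlockLawHyp` (= F0P3a-p08 (g20)'s).  THEOREMS ONLY (no definition, no instance, no notation,
no named fact, no `sorry`); kernel lane `--supports stmt-HodgeConjecture-24833`.  Cell `pub/hodgecm-mathlib` (D-0151), crux H413; road «S3-ram» (Literature seeding,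
count-neutral).  **`zhyp_zero_odd_A_ram` = the keeper's v2.2 cell `stub_Zhyp_zero_odd_A` VERBATIM** (text `F0/P3a/F0P3a-p06/g16/blocklaw/v2_2/stub_Zhyp_zero_odd_A.v2_2.F0P3ap06g16.txt`
= chair F0P3a-p07 (g15)'s α-equivalent `…/pmjoint/stub_Zhyp_zero_odd_A.F0P3ap07g15.txt`; only the three idle frame binders renamed `_hH' _hA _hframe`, positions unchanged),
CLOSED — so the keeper writes `stub_Zhyp_zero_odd_A := zhyp_zero_odd_A_ram L H' hH' w hw he hH'w _hH'i h2 ϖ hϖ hσϖ A hA hframe`.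

THE COMPOSITION.  Regime A-odd ∕ C: `N = 2n + 1 = m = 2mA + 3`.  Centre the hyperbolic literal `ι(ĝ_w, û_w)` to `Γ = ι(B₀, 1)`, `B₀ = k⁻¹(s·ĝ_w)k` (`s·û₀₀ = 1`; the W-centre `k`
of A-p12 (g25) ∕ A-p19 (g29) ★ `exists_centre_forall_v_rerootedCentred_sub_one_le_of_odd_ram`: `|B₀ − 1| ≤ |ϖ|^m`).  The row-`0` total is ★ p849287 (F0P3a-p08 (g20)) in the root
region `sR` and the collar atoms `(NE, NP, NM)`; this seat's `rootRegionCensus_hyperbolic_odd` (p849494 ∘ ★ p849330 ∘ ★ p849383 ∘ ★ p849462) gives `sR = {L₀}` — the W-root-set of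
`B₀` at level `m` is `{𝒪²}`: its size is A-p12's centred ball count at scale `ϖ^m ∼ ϖ^{2n}` (★ A-p19 `ncard_selfDual_fixed_lev_rerootedCentred_eq_ncard_ball_ram`, scalar depth
`≤ |ϖ^N|` by chair's ★ `typeTwo_depthDictionary_odd_ram`; ★ A-p12 `selfDual_fixed_ball_odd_scale_eq`, `ncard_selfDual_fixed_ball_of_odd_depth_ramified` at `j = n`: ONE member) —
and atoms `q·(νE, νP, νM)` with `νE + νP + νM = q + 1`, `νE = 1 + χ(det Ȳ_W) ∈ {2, 0}`, `Ȳ_W` the residual leading block (`= !![β̄, y; x, β̄]`, `χ(xy) = −1`; regime C is the tie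
`β̄ ≠ 0`).  Finally `χ(det Ȳ_W) = (β, θ)_v`: `det(B₀ − 1) = s²·(χ_g(u))_w` (★ A-p19 `det_coe_inv_conj_scalar_mul_sub_one`, ★ `eval_finCharpolyTwo_finGammaTwo_apply_eq_quadratic`) and
chair's ★ `typeTwo_hilbertSymbol_eq_one_iff_exists_sq_ram` (`(β,θ)_v = 1 ⟺ (χ_g(u))_w ∕ ϖ^{2m}` is residually a non-zero square).
HONEST LABEL: HC_CM is proved only modulo the 2 remaining named inputs (hLiu418 24832, h413 24833) until rung 0 closes; nothing printed is asserted here (composition of ★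
theorems); «S3-ram» has no books consequence.

## References
* [Rogawski1990] J. D. Rogawski, *Automorphic Representations of Unitary Groups in Three Variables*, Ann. of Math. Stud. 123 (1990), §4.9 Prop. 4.9.1 (b) p. 55, Lemma 4.9.3 p. 56.
* [Kottwitz1986] R. E. Kottwitz, *Base change for unit elements of Hecke algebras*, Compositio Math. 60 (1986), §3.
* [LabesseLanglands1979] J.-P. Labesse, R. P. Langlands, *L-indistinguishability for SL(2)*, Canad. J. Math. 31 (1979), §2 Lemma 2.1.
* [BruhatTits1972] F. Bruhat, J. Tits, *Groupes réductifs sur un corps local I*, Publ. Math. IHÉS 41 (1972), §10.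
-/

set_option autoImplicit false

noncomputable section

open NumberField IsDedekindDomain Matrix Polynomial ValuativeRel
open Literature.NumberTheory.Automorphic Literature.NumberTheory.Automorphic.UnitaryGroup
open Literature.NumberTheory.Automorphic.UnitaryLatticeTree Literature.NumberTheory.Automorphic.HermitianLattice
open Literature.NumberTheory.GaloisRepresentations Literature.NumberTheory.QuadraticForms
open Literature.NumberTheory.Rogawski1990 Literature.NumberTheory.Rogawski1990.TypeOneRamifiedJunction
open scoped Matrix MatrixGroups ValuativeRel WithZero

namespace Literature.NumberTheory.Rogawski1990.BlockLawHyp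

set_option maxHeartbeats 3200000 in
-- budget only: the keeper's statement-heavy socket telescope (verbatim); the proof is a composition of ★ heads.
/-- **THE KEEPER'S CELL `stub_Zhyp_zero_odd_A`, CLOSED** (regimes A-odd ∕ C, row `0`, hyperbolic literal): `∃ NE P, (#A : ℂ) = 1 + NE·(Σ_{i<mA+1} q^{2i} + Σ_{i<mA} q^{2mA+1+i}) +
P·Σ_{i<mA} q^{2i}` with `(NE, P) = (2q, (q−1)q)` if `(β,θ)_v = 1` and `(0, (q+1)q)` if `(β,θ)_v = −1` — ★ p849287 ∘ `rootRegionCensus_hyperbolic_odd` ∘ (A-p19 ∕ A-p12 W-side, chair's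
dictionary and sign lemma). [cite: Rogawski1990, §4.9 Prop. 4.9.1 (b) p. 55, Lemma 4.9.3 p. 56] [cite: Kottwitz1986, §3] [cite: LabesseLanglands1979, §2 Lemma 2.1] [cite: BruhatTits1972, §10] -/
theorem zhyp_zero_odd_A_ram
    (L : Type) [Field L] [NumberField L] [IsCMField L] (H' : Matrix (Fin 3) (Fin 3) L)
    {v : HeightOneSpectrum (𝓞 ↥(maximalRealSubfield L))}
    (_hH' : (H'.map (cmConjRingHom L)).transpose = H') (w : PlacesOver L v)
    (hw : IsCMField.complexConj L • w.1 = w.1) (he : v.asIdeal.ramificationIdx' w.1.asIdeal ≠ 1)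
    (hH'w : IsUnit (placeForm H' w.1)) (_hH'i : hH'w.unit ∈ glInt 3 (w.1.adicCompletion L))
    (h2 : IsUnit (2 : 𝒪[(w.1.adicCompletion L)]))
    (ϖ : w.1.adicCompletion L) (hϖ : Valued.v ϖ = WithZero.exp (-1 : ℤ)) (hσϖ : galAdicCompletionMap (L := L) (IsCMField.complexConj L) hw ϖ = -ϖ)
    (A : GL (Fin 3) (w.1.adicCompletion L)) (_hA : A ∈ glInt 3 (w.1.adicCompletion L))
    (_hframe : placeForm H' w.1 = (-(placeForm H' w.1).det) • formCongr (galAdicCompletionMap (L := L) (IsCMField.complexConj L) hw) A ((StdForm.antidiagonal 3).over (w.1.adicCompletion L))) :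

    ∀ ⦃γH : ((cmDatum L 2 (Matrix.of fun i j : Fin 2 => if i.val + j.val + 1 = 2 then (1 : L) else 0)).Local v × (cmDatum L 1 (Matrix.of fun i j : Fin 1 => if i.val + j.val + 1 = 1 then (1 : L) else 0)).Local v)⦄,
      (∀ i j : Fin 2, Valued.v (((((γH.1.val : GL (Fin 2) (UnitaryGroup.LocalRing L v)).val.map (Pi.evalRingHom (fun w' : PlacesOver L v => w'.1.adicCompletion L) w))) - 1) i j) ≤ Valued.v (ϖ ^ 2)) → Valued.v (finGammaTwo L v γH w - 1) ≤ Valued.v (ϖ ^ 2) → IsLocalGRegular L v γH →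
      (¬ ∃ x : (w.1.adicCompletion L), ((((γH.1.val : GL (Fin 2) (UnitaryGroup.LocalRing L v)).val.map (Pi.evalRingHom (fun w' : PlacesOver L v => w'.1.adicCompletion L) w))).charpoly).IsRoot x) → ∀ ⦃n : ℕ⦄,
      Valued.v ((((γH.1.val : GL (Fin 2) (UnitaryGroup.LocalRing L v)).val.map (Pi.evalRingHom (fun w' : PlacesOver L v => w'.1.adicCompletion L) w))).trace ^ 2 - 4 * (((γH.1.val : GL (Fin 2) (UnitaryGroup.LocalRing L v)).val.map (Pi.evalRingHom (fun w' : PlacesOver L v => w'.1.adicCompletion L) w))).det) = WithZero.exp (-((2 * (2 * n + 1) : ℕ) : ℤ)) → 1 ≤ n →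
      ∀ (m : ℕ), Valued.v (((finCharpolyTwo L v γH).eval (finGammaTwo L v γH)) w) =
          Valued.v ((toPlace v w (HeckeCharacter.uniformizer ↥(maximalRealSubfield L) v : v.adicCompletion ↥(maximalRealSubfield L))) ^ m) →
        ∀ β : (v.adicCompletion ↥(maximalRealSubfield L))ˣ, toPlace v w (β : v.adicCompletion ↥(maximalRealSubfield L)) =
          -(((finCharpolyTwo L v γH).eval (finGammaTwo L v γH)) w *
              (finGammaTwo L v γH w ^ 2 +
                ((γH.1.val.val : Matrix (Fin 2) (Fin 2) (LocalRing L v)).map (Pi.evalRingHom (fun w' : PlacesOver L v => w'.1.adicCompletion L) w)).det)) /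
            (2 * finGammaTwo L v γH w ^ 2 *
              ((γH.1.val.val : Matrix (Fin 2) (Fin 2) (LocalRing L v)).map (Pi.evalRingHom (fun w' : PlacesOver L v => w'.1.adicCompletion L) w)).det) →
        ∀ (P₁ : GL (Fin 3) (w.1.adicCompletion L)) (d : Fin 2 → (w.1.adicCompletion L)) (η : (w.1.adicCompletion L)) (γ₁ : GL (Fin 2) (w.1.adicCompletion L)),
        P₁ ∈ glInt 3 (w.1.adicCompletion L) →
        formCongr (galAdicCompletionMap (L := L) (IsCMField.complexConj L) hw) P₁ (placeForm (Matrix.of fun i j : Fin 3 => if i.val + j.val + 1 = 3 then (1 : L) else 0) w.1) = !![(Matrix.diagonal d) 0 0, 0, (Matrix.diagonal d) 0 1; 0, η, 0; (Matrix.diagonal d) 1 0, 0, (Matrix.diagonal d) 1 1] →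
        (∀ i, Valued.v (d i) = 1) → (∀ i, (galAdicCompletionMap (L := L) (IsCMField.complexConj L) hw) (d i) = d i) →
        (∀ z : (w.1.adicCompletion L), Valued.v z ≤ 1 → Valued.v (d 0 + d 1 * ((galAdicCompletionMap (L := L) (IsCMField.complexConj L) hw) z * z)) = 1) →
        (∀ z : (w.1.adicCompletion L), Valued.v z ≤ 1 → Valued.v (d 0 * ((galAdicCompletionMap (L := L) (IsCMField.complexConj L) hw) z * z) + d 1) = 1) →
        (galAdicCompletionMap (L := L) (IsCMField.complexConj L) hw) η = η → Valued.v η = 1 →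
        (∀ i j, Valued.v (((γ₁ : Matrix (Fin 2) (Fin 2) (w.1.adicCompletion L)) - 1) i j) ≤ Valued.v (ϖ ^ 2)) →
        γ₁ ∈ unitaryGroupOfForm (galAdicCompletionMap (L := L) (IsCMField.complexConj L) hw) (Matrix.diagonal d) →
        (γ₁ : Matrix (Fin 2) (Fin 2) (w.1.adicCompletion L)).charpoly = (((γH.1.val : GL (Fin 2) (UnitaryGroup.LocalRing L v)).val.map (Pi.evalRingHom (fun w' : PlacesOver L v => w'.1.adicCompletion L) w))).charpoly →
        Valued.v ((γ₁ : Matrix (Fin 2) (Fin 2) (w.1.adicCompletion L)).trace ^ 2 - 4 * (γ₁ : Matrix (Fin 2) (Fin 2) (w.1.adicCompletion L)).det) = WithZero.exp (-((2 * (2 * n + 1) : ℕ) : ℤ)) →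
        (¬ ∃ x : (w.1.adicCompletion L), ((γ₁ : Matrix (Fin 2) (Fin 2) (w.1.adicCompletion L)).charpoly).IsRoot x) →
        (¬ ∃ t : (w.1.adicCompletion L), t * (galAdicCompletionMap (L := L) (IsCMField.complexConj L) hw) t = η) →
          ∀ (mA : ℕ), n = mA + 1 → m = 2 * n + 1 → ∃ (NE P : ℕ),
          ({M : Submodule (Valued.integer (w.1.adicCompletion L)) (Fin 3 → (w.1.adicCompletion L)) | IsSelfDualLattice (galAdicCompletionMap (L := L) (IsCMField.complexConj L) hw) ϖ (placeForm (Matrix.of fun i j : Fin 3 => if i.val + j.val + 1 = 3 then (1 : L) else 0) w.1) M ∧ mapGL (endoGL (((localNonsplitEquiv (IsCMField.complexConj L) (Matrix.of fun i j : Fin 2 => if i.val + j.val + 1 = 2 then (1 : L) else 0) (IsCMField.complexConj_ne_one L) w hw γH.1).val : GL (Fin 2) (w.1.adicCompletion L)), ((localNonsplitEquiv (IsCMField.complexConj L) (Matrix.of fun i j : Fin 1 => if i.val + j.val + 1 = 1 then (1 : L) else 0) (IsCMField.complexConj_ne_one L) w hw γH.2).val : GL (Fin 1) (w.1.adicCompletion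 L)))) M = M ∧ M.map ((Matrix.toLin' (((endoGL (((localNonsplitEquiv (IsCMField.complexConj L) (Matrix.of fun i j : Fin 2 => if i.val + j.val + 1 = 2 then (1 : L) else 0) (IsCMField.complexConj_ne_one L) w hw γH.1).val : GL (Fin 2) (w.1.adicCompletion L)), ((localNonsplitEquiv (IsCMField.complexConj L) (Matrix.of fun i j : Fin 1 => if i.val + j.val + 1 = 1 then (1 : L) else 0) (IsCMField.complexConj_ne_one L) w hw γH.2).val : GL (Fin 1) (w.1.adicCompletion L))) : GL (Fin 3) (w.1.adicCompletion L)) : Matrix (Fin 3) (Fin 3) (w.1.adicCompletion L)) - 1)).restrictScalars (Valued.integer (w.1.adicCompletion L))) ≤ scaleLattice (ϖ ^ 2) M}.ncard : ℂ) =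
            1 + (NE : ℂ) * (∑ i ∈ Finset.range (mA + 1), (Ideal.absNorm v.asIdeal : ℂ) ^ (2 * i) + ∑ i ∈ Finset.range mA, (Ideal.absNorm v.asIdeal : ℂ) ^ (2 * mA + 1 + i)) + (P : ℂ) * ∑ i ∈ Finset.range mA, (Ideal.absNorm v.asIdeal : ℂ) ^ (2 * i) ∧
          (hilbertSymbol (v.adicCompletion ↥(maximalRealSubfield L)) (β : v.adicCompletion ↥(maximalRealSubfield L)) (algebraMap ↥(maximalRealSubfield L) _ ((cmQuadraticGenerator L : 𝓞 ↥(maximalRealSubfield L)) : ↥(maximalRealSubfield L))) = 1 → (NE : ℂ) = 2 * (Ideal.absNorm v.asIdeal : ℂ) ∧ (P : ℂ) = ((Ideal.absNorm v.asIdeal : ℂ) - 1) * (Ideal.absNorm v.asIdeal : ℂ)) ∧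
          (hilbertSymbol (v.adicCompletion ↥(maximalRealSubfield L)) (β : v.adicCompletion ↥(maximalRealSubfield L)) (algebraMap ↥(maximalRealSubfield L) _ ((cmQuadraticGenerator L : 𝓞 ↥(maximalRealSubfield L)) : ↥(maximalRealSubfield L))) = -1 → (NE : ℂ) = 0 ∧ (P : ℂ) = ((Ideal.absNorm v.asIdeal : ℂ) + 1) * (Ideal.absNorm v.asIdeal : ℂ)) := by
  intro γH hblk hu2 _hreg hirr n hdisc _hn m hm β hβ P₁ d η γ₁ _hP₁ _hform _hd _hσd _han₀ _han₁ _hση _hηv _hγ2 _hγU _hχ _hdiscγ _hirrγ _hηN mA hnA hmN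
  classical
  have hmA : m = 2 * mA + 3 := by omega
  have hmodd : Odd m := ⟨n, by omega⟩
  have hm3 : 3 ≤ m := by omega
  -- THE CM DRESS
  have hc1 : IsCMField.complexConj L ≠ 1 := IsCMField.complexConj_ne_one L
  have h2v : Valued.v (2 : (w.1.adicCompletion L)) = 1 := (isUnit_two_integer_iff_valued_eq_one L w.1).1 h2
  have hσσ : ∀ z : (w.1.adicCompletion L), (galAdicCompletionMap (L := L) (IsCMField.complexConj L) hw) ((galAdicCompletionMap (L := L) (IsCMField.complexConj L) hw) z) = z :=
    galAdicCompletionMap_galAdicCompletionMap_of_smul_eq (IsCMField.complexConj L) w hc1 hw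
  have hvσ : ∀ z : (w.1.adicCompletion L), Valued.v ((galAdicCompletionMap (L := L) (IsCMField.complexConj L) hw) z) = Valued.v z := fun z =>
    valued_galAdicCompletionMap (L := L) (IsCMField.complexConj L) hw z
  obtain ⟨-, -, -, hres, hnorm⟩ := ramifiedBlock_adicCompletion L v w hw he h2v
  haveI : Fintype (Valued.ResidueField (w.1.adicCompletion L)) := Fintype.ofFinite _
  haveI := isPrincipalIdealRing_integer_adicCompletion L v w
  have hqN : (Nat.card (Valued.ResidueField (w.1.adicCompletion L)) : ℂ) = (Ideal.absNorm v.asIdeal : ℂ) := by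
    congr 1
    rw [← natCard_residueField_eq_of_compatible, natCard_residueField_eq_of_ramified (IsCMField.complexConj L) v hc1 w hw he, Ideal.absNorm_apply, Submodule.cardQuot_apply]
  have hsq : ∀ t : (w.1.adicCompletion L), Valued.v (t - 1) < 1 → IsSquare t := fun t ht => by
    obtain ⟨r, hr, -⟩ := exists_sq_eq_of_valued_sub_one_lt w.1 h2v t ht
    exact ⟨r, by rw [← hr, sq]⟩
  have hϖ0 : ϖ ≠ 0 := fun h0 => by rw [h0, Valuation.map_zero] at hϖ; exact WithZero.exp_ne_zero hϖ.symm
  have hϖlt : Valued.v ϖ < 1 := by rw [hϖ, ← WithZero.exp_zero]; exact WithZero.exp_lt_exp.2 (by norm_num)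
  have hlt1 : Valued.v ϖ ^ m < 1 := pow_lt_one₀ zero_le hϖlt (by omega)
  have hT := isTree_latticeGraph_three_of_neg hσσ hvσ hϖ hσϖ hres h2v hnorm
  -- the centring unit `s` (`s·û₀₀ = 1`) and the W-centre `k` (A-p19 ∕ A-p12): `|B₀ − 1| ≤ |ϖ|^m`, `B₀ = k⁻¹(s·ĝ_w)k`
  obtain ⟨s, hs⟩ := exists_units_mul_oneByOne_eq_one ((localNonsplitEquiv (IsCMField.complexConj L) (Matrix.of fun i j : Fin 1 => if i.val + j.val + 1 = 1 then (1 : L) else 0) (IsCMField.complexConj_ne_one L) w hw γH.2).val : GL (Fin 1) (w.1.adicCompletion L))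
  obtain ⟨k, hk, hd⟩ := exists_centre_forall_v_rerootedCentred_sub_one_le_of_odd_ram L w hw he h2 ϖ hϖ hσϖ γH hblk hu2 hirr hdisc m hm β hβ s hs
  let γ' : unitaryGroupOfForm (galAdicCompletionMap (L := L) (IsCMField.complexConj L) hw) ((StdForm.antidiagonal 3).over (w.1.adicCompletion L)) :=
    ⟨endoGL ((k⁻¹ * (Matrix.GeneralLinearGroup.scalar (Fin 2) s * ((localNonsplitEquiv (IsCMField.complexConj L) (Matrix.of fun i j : Fin 2 => if i.val + j.val + 1 = 2 then (1 : L) else 0) (IsCMField.complexConj_ne_one L) w hw γH.1).val : GL (Fin 2) (w.1.adicCompletion L))) * k : GL (Fin 2) (w.1.adicCompletion L)), (1 : GL (Fin 1) (w.1.adicCompletion L))), endoGL_rerootedCentred_mem_unitaryGroupOfForm_ram L w hw γH s hs k hk⟩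
  have hγ' : (γ' : GL (Fin 3) (w.1.adicCompletion L)) = endoGL ((k⁻¹ * (Matrix.GeneralLinearGroup.scalar (Fin 2) s * ((localNonsplitEquiv (IsCMField.complexConj L) (Matrix.of fun i j : Fin 2 => if i.val + j.val + 1 = 2 then (1 : L) else 0) (IsCMField.complexConj_ne_one L) w hw γH.1).val : GL (Fin 2) (w.1.adicCompletion L))) * k : GL (Fin 2) (w.1.adicCompletion L)), (1 : GL (Fin 1) (w.1.adicCompletion L))) := rfl
  have hγ'0 : γ' ∈ unitaryInt (galAdicCompletionMap (L := L) (IsCMField.complexConj L) hw) ((StdForm.antidiagonal 3).over (w.1.adicCompletion L)) :=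
    endoGL_one_mem_unitaryInt hϖlt _ (d := m) (by omega) hd
  -- `B₀ ∈ U(σ_w, !![0,1;1,0])`
  have hk' : k ∈ unitaryGroupOfForm (galAdicCompletionMap (L := L) (IsCMField.complexConj L) hw) (!![(0 : w.1.adicCompletion L), 1; 1, 0] : Matrix (Fin 2) (Fin 2) (w.1.adicCompletion L)) := by
    rw [← unitaryGroupOfForm_placeForm_antidiagTwo_eq]; exact hk
  have hg' : ((localNonsplitEquiv (IsCMField.complexConj L) (Matrix.of fun i j : Fin 2 => if i.val + j.val + 1 = 2 then (1 : L) else 0) (IsCMField.complexConj_ne_one L) w hw γH.1).val : GL (Fin 2) (w.1.adicCompletion L)) ∈ unitaryGroupOfForm (galAdicCompletionMap (L := L) (IsCMField.complexConj L) hw) (!![(0 : w.1.adicCompletion L), 1; 1, 0] : Matrix (Fin 2) (Fin 2) (w.1.adicCompletion L)) := by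
    rw [← unitaryGroupOfForm_placeForm_antidiagTwo_eq]
    exact (localNonsplitEquiv (IsCMField.complexConj L) (Matrix.of fun i j : Fin 2 => if i.val + j.val + 1 = 2 then (1 : L) else 0) (IsCMField.complexConj_ne_one L) w hw γH.1).2
  have hsnorm : (galAdicCompletionMap (L := L) (IsCMField.complexConj L) hw) (s : (w.1.adicCompletion L)) * (s : (w.1.adicCompletion L)) = 1 :=
    map_mul_self_eq_one_of_mul_oneByOne_eq_one (oneByOne_mem_unitaryGroupOfForm_antidiagonal_of_local L w hw γH.2) hs
  have hU : (k⁻¹ * (Matrix.GeneralLinearGroup.scalar (Fin 2) s * ((localNonsplitEquiv (IsCMField.complexConj L) (Matrix.of fun i j : Fin 2 => if i.val + j.val + 1 = 2 then (1 : L) else 0) (IsCMField.complexConj_ne_one L) w hw γH.1).val : GL (Fin 2) (w.1.adicCompletion L))) * k : GL (Fin 2) (w.1.adicCompletion L)) ∈ unitaryGroupOfForm (galAdicCompletionMap (L := L) (IsCMField.complexConj L) hw) (!![(0 : w.1.adicCompletion L), 1; 1, 0] : Matrix (Fin 2) (Fin 2) (w.1.adicCompletion L)) :=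
    Subgroup.mul_mem _ (Subgroup.mul_mem _ (Subgroup.inv_mem _ hk') (scalar_mul_mem_unitaryGroupOfForm hg' s hsnorm)) hk'
  -- the spectral data of `B₀`
  have hirr' := not_exists_isRoot_charpoly_rerootedCentred_ram L w hw γH hirr s k
  have hdisc' : Valued.v (((k⁻¹ * (Matrix.GeneralLinearGroup.scalar (Fin 2) s * ((localNonsplitEquiv (IsCMField.complexConj L) (Matrix.of fun i j : Fin 2 => if i.val + j.val + 1 = 2 then (1 : L) else 0) (IsCMField.complexConj_ne_one L) w hw γH.1).val : GL (Fin 2) (w.1.adicCompletion L))) * k : GL (Fin 2) (w.1.adicCompletion L)) : Matrix (Fin 2) (Fin 2) (w.1.adicCompletion L)).trace ^ 2 - 4 * ((k⁻¹ * (Matrix.GeneralLinearGroup.scalar (Fin 2) s * ((localNonsplitEquiv (IsCMField.complexConj L) (Matrix.of fun i j : Fin 2 => if i.val + j.val + 1 = 2 then (1 : L) else 0) (IsCMField.complexConj_ne_one L) w hw γH.1).val : GL (Fin 2) (w.1.adicCompletion L))) * k : GL (Fin 2) (w.1.adicCompletion L)) : Matrix (Fin 2) (Fin 2) (w.1.adicCompletion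 L)).det) = Valued.v ϖ ^ (2 * m) := by
    rw [v_disc_rerootedCentred_ram L w hw γH s hs k, hdisc, hϖ, ← WithZero.exp_nsmul, hmN]
    congr 1; push_cast; ring
  -- the leading matrix `Y = (ϖ^m)⁻¹(B₀ − 1) ∈ M₂(𝒪_w)`
  let Y : Matrix (Fin 2) (Fin 2) (Valued.integer (w.1.adicCompletion L)) := Matrix.of fun i j =>
    ⟨(ϖ ^ m)⁻¹ * (((k⁻¹ * (Matrix.GeneralLinearGroup.scalar (Fin 2) s * ((localNonsplitEquiv (IsCMField.complexConj L) (Matrix.of fun i j : Fin 2 => if i.val + j.val + 1 = 2 then (1 : L) else 0) (IsCMField.complexConj_ne_one L) w hw γH.1).val : GL (Fin 2) (w.1.adicCompletion L))) * k : GL (Fin 2) (w.1.adicCompletion L)) : Matrix (Fin 2) (Fin 2) (w.1.adicCompletion L)) - 1) i j, (Valuation.mem_integer_iff _ _).2 (by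
      rw [Valuation.map_mul, map_inv₀, map_pow]
      calc (Valued.v ϖ ^ m)⁻¹ * Valued.v ((((k⁻¹ * (Matrix.GeneralLinearGroup.scalar (Fin 2) s * ((localNonsplitEquiv (IsCMField.complexConj L) (Matrix.of fun i j : Fin 2 => if i.val + j.val + 1 = 2 then (1 : L) else 0) (IsCMField.complexConj_ne_one L) w hw γH.1).val : GL (Fin 2) (w.1.adicCompletion L))) * k : GL (Fin 2) (w.1.adicCompletion L)) : Matrix (Fin 2) (Fin 2) (w.1.adicCompletion L)) - 1) i j) ≤ (Valued.v ϖ ^ m)⁻¹ * Valued.v ϖ ^ m := mul_le_mul' le_rfl (hd i j)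
        _ = 1 := inv_mul_cancel₀ (pow_ne_zero _ ((Valuation.ne_zero_iff _).2 hϖ0)))⟩
  have hY : ∀ i j, ((Y i j : Valued.integer (w.1.adicCompletion L)) : (w.1.adicCompletion L)) = (ϖ ^ m)⁻¹ * (((k⁻¹ * (Matrix.GeneralLinearGroup.scalar (Fin 2) s * ((localNonsplitEquiv (IsCMField.complexConj L) (Matrix.of fun i j : Fin 2 => if i.val + j.val + 1 = 2 then (1 : L) else 0) (IsCMField.complexConj_ne_one L) w hw γH.1).val : GL (Fin 2) (w.1.adicCompletion L))) * k : GL (Fin 2) (w.1.adicCompletion L)) : Matrix (Fin 2) (Fin 2) (w.1.adicCompletion L)) - 1) i j := fun i j => rfl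
  -- THE W-ROOT-SET OF `B₀` AT LEVEL `m` IS `{𝒪²}` (A-p19 transport + chair's scalar depth + A-p12's innermost odd ball)
  obtain ⟨-, -, hA⟩ := typeTwo_depthDictionary_odd_ram L w hw he h2 ϖ hϖ hσϖ hblk hu2 hirr hdisc m hm β hβ
  obtain ⟨hHS, hsc⟩ := hA hmN
  have hsc' : Valued.v (2 * finGammaTwo L v γH w - ((((γH.1.val : GL (Fin 2) (UnitaryGroup.LocalRing L v)).val.map
      (Pi.evalRingHom (fun w' : PlacesOver L v => w'.1.adicCompletion L) w)))).trace) ≤ Valued.v (ϖ ^ m) := by rw [hmN]; exact hsc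
  have hWc := ncard_selfDual_fixed_lev_rerootedCentred_eq_ncard_ball_ram L w hw he h2 ϖ hϖ γH s hs k hk m hsc'
  have hball := selfDual_fixed_ball_odd_scale_eq L v w hw he h2 (Units.mk0 ϖ hϖ0) hϖ hσϖ (ϖ' := ϖ) ((localNonsplitEquiv (IsCMField.complexConj L) (Matrix.of fun i j : Fin 2 => if i.val + j.val + 1 = 2 then (1 : L) else 0) (IsCMField.complexConj_ne_one L) w hw γH.1).val : GL (Fin 2) (w.1.adicCompletion L))
    (localNonsplitEquiv (IsCMField.complexConj L) (Matrix.of fun i j : Fin 2 => if i.val + j.val + 1 = 2 then (1 : L) else 0) (IsCMField.complexConj_ne_one L) w hw γH.1).2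
    hblk hdisc (j := n) (by omega)
  have hcnt := ncard_selfDual_fixed_ball_of_odd_depth_ramified L v w hw he h2 (Units.mk0 ϖ hϖ0) hϖ hσϖ γH.1 hirr hblk hdisc (j := n) le_rfl
  simp only [Units.val_mk0] at hball hcnt
  rw [show n - n + 1 = 1 by omega, Finset.sum_range_one, pow_zero, mul_one] at hcnt
  have hball' : {B : Submodule (Valued.integer (w.1.adicCompletion L)) (Fin 2 → (w.1.adicCompletion L)) |
        IsSelfDualLattice (galAdicCompletionMap (L := L) (IsCMField.complexConj L) hw) ϖ (!![(0 : w.1.adicCompletion L), 1; 1, 0] : Matrix (Fin 2) (Fin 2) (w.1.adicCompletion L)) B ∧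
        mapGL ((localNonsplitEquiv (IsCMField.complexConj L) (Matrix.of fun i j : Fin 2 => if i.val + j.val + 1 = 2 then (1 : L) else 0) (IsCMField.complexConj_ne_one L) w hw γH.1).val : GL (Fin 2) (w.1.adicCompletion L)) B = B ∧
        B.map ((Matrix.toLin' ((((localNonsplitEquiv (IsCMField.complexConj L) (Matrix.of fun i j : Fin 2 => if i.val + j.val + 1 = 2 then (1 : L) else 0) (IsCMField.complexConj_ne_one L) w hw γH.1).val : GL (Fin 2) (w.1.adicCompletion L)) : Matrix (Fin 2) (Fin 2) (w.1.adicCompletion L)) - ((((localNonsplitEquiv (IsCMField.complexConj L) (Matrix.of fun i j : Fin 2 => if i.val + j.val + 1 = 2 then (1 : L) else 0) (IsCMField.complexConj_ne_one L) w hw γH.1).val : GL (Fin 2) (w.1.adicCompletion L)) : Matrix (Fin 2) (Fin 2) (w.1.adicCompletion L)).trace / 2) • (1 : Matrix (Fin 2) (Fin 2) (w.1.adicCompletion L)))).restrictScalars (Valued.integer (w.1.adicCompletion L))) ≤ scaleLattice (ϖ ^ (m)) B} = {B : Submodule (Valued.integer (w.1.adicCompletion L)) (Fin 2 → (w.1.adicCompletion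 L)) |
        IsSelfDualLattice (galAdicCompletionMap (L := L) (IsCMField.complexConj L) hw) ϖ (!![(0 : w.1.adicCompletion L), 1; 1, 0] : Matrix (Fin 2) (Fin 2) (w.1.adicCompletion L)) B ∧
        mapGL ((localNonsplitEquiv (IsCMField.complexConj L) (Matrix.of fun i j : Fin 2 => if i.val + j.val + 1 = 2 then (1 : L) else 0) (IsCMField.complexConj_ne_one L) w hw γH.1).val : GL (Fin 2) (w.1.adicCompletion L)) B = B ∧
        B.map ((Matrix.toLin' ((((localNonsplitEquiv (IsCMField.complexConj L) (Matrix.of fun i j : Fin 2 => if i.val + j.val + 1 = 2 then (1 : L) else 0) (IsCMField.complexConj_ne_one L) w hw γH.1).val : GL (Fin 2) (w.1.adicCompletion L)) : Matrix (Fin 2) (Fin 2) (w.1.adicCompletion L)) - ((((localNonsplitEquiv (IsCMField.complexConj L) (Matrix.of fun i j : Fin 2 => if i.val + j.val + 1 = 2 then (1 : L) else 0) (IsCMField.complexConj_ne_one L) w hw γH.1).val : GL (Fin 2) (w.1.adicCompletion L)) : Matrix (Fin 2) (Fin 2) (w.1.adicCompletion L)).trace / 2) • (1 : Matrix (Fin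 2) (Fin 2) (w.1.adicCompletion L)))).restrictScalars (Valued.integer (w.1.adicCompletion L))) ≤ scaleLattice (ϖ ^ (2 * n)) B} := by
    rw [hmN]; exact hball
  have hW1 : {B : Submodule (Valued.integer (w.1.adicCompletion L)) (Fin 2 → (w.1.adicCompletion L)) |
        IsSelfDualLattice (galAdicCompletionMap (L := L) (IsCMField.complexConj L) hw) ϖ (!![(0 : w.1.adicCompletion L), 1; 1, 0] : Matrix (Fin 2) (Fin 2) (w.1.adicCompletion L)) B ∧
        mapGL (k⁻¹ * (Matrix.GeneralLinearGroup.scalar (Fin 2) s * ((localNonsplitEquiv (IsCMField.complexConj L) (Matrix.of fun i j : Fin 2 => if i.val + j.val + 1 = 2 then (1 : L) else 0) (IsCMField.complexConj_ne_one L) w hw γH.1).val : GL (Fin 2) (w.1.adicCompletion L))) * k : GL (Fin 2) (w.1.adicCompletion L)) B = B ∧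
        B.map ((Matrix.toLin' (((k⁻¹ * (Matrix.GeneralLinearGroup.scalar (Fin 2) s * ((localNonsplitEquiv (IsCMField.complexConj L) (Matrix.of fun i j : Fin 2 => if i.val + j.val + 1 = 2 then (1 : L) else 0) (IsCMField.complexConj_ne_one L) w hw γH.1).val : GL (Fin 2) (w.1.adicCompletion L))) * k : GL (Fin 2) (w.1.adicCompletion L)) : Matrix (Fin 2) (Fin 2) (w.1.adicCompletion L)) - 1)).restrictScalars (Valued.integer (w.1.adicCompletion L))) ≤ scaleLattice (ϖ ^ m) B}.ncard = 1 := by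
    rw [hWc, hball']; omega
  have hBint : IsIntMatrix ((k⁻¹ * (Matrix.GeneralLinearGroup.scalar (Fin 2) s * ((localNonsplitEquiv (IsCMField.complexConj L) (Matrix.of fun i j : Fin 2 => if i.val + j.val + 1 = 2 then (1 : L) else 0) (IsCMField.complexConj_ne_one L) w hw γH.1).val : GL (Fin 2) (w.1.adicCompletion L))) * k : GL (Fin 2) (w.1.adicCompletion L)) : Matrix (Fin 2) (Fin 2) (w.1.adicCompletion L)) := isIntMatrix_of_forall_v_sub_one_lt_one _ fun i j => (hd i j).trans_lt hlt1
  have hBinv : IsIntMatrix (((k⁻¹ * (Matrix.GeneralLinearGroup.scalar (Fin 2) s * ((localNonsplitEquiv (IsCMField.complexConj L) (Matrix.of fun i j : Fin 2 => if i.val + j.val + 1 = 2 then (1 : L) else 0) (IsCMField.complexConj_ne_one L) w hw γH.1).val : GL (Fin 2) (w.1.adicCompletion L))) * k : GL (Fin 2) (w.1.adicCompletion L))⁻¹ : GL (Fin 2) (w.1.adicCompletion L)) : Matrix (Fin 2) (Fin 2) (w.1.adicCompletion L)) :=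
    isIntMatrix_coe_inv_of_forall_v_sub_one_le_of_lt_one hlt1 hd
  have hstd : stdLattice (w.1.adicCompletion L) 2 ∈ {B : Submodule (Valued.integer (w.1.adicCompletion L)) (Fin 2 → (w.1.adicCompletion L)) |
        IsSelfDualLattice (galAdicCompletionMap (L := L) (IsCMField.complexConj L) hw) ϖ (!![(0 : w.1.adicCompletion L), 1; 1, 0] : Matrix (Fin 2) (Fin 2) (w.1.adicCompletion L)) B ∧
        mapGL (k⁻¹ * (Matrix.GeneralLinearGroup.scalar (Fin 2) s * ((localNonsplitEquiv (IsCMField.complexConj L) (Matrix.of fun i j : Fin 2 => if i.val + j.val + 1 = 2 then (1 : L) else 0) (IsCMField.complexConj_ne_one L) w hw γH.1).val : GL (Fin 2) (w.1.adicCompletion L))) * k : GL (Fin 2) (w.1.adicCompletion L)) B = B ∧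
        B.map ((Matrix.toLin' (((k⁻¹ * (Matrix.GeneralLinearGroup.scalar (Fin 2) s * ((localNonsplitEquiv (IsCMField.complexConj L) (Matrix.of fun i j : Fin 2 => if i.val + j.val + 1 = 2 then (1 : L) else 0) (IsCMField.complexConj_ne_one L) w hw γH.1).val : GL (Fin 2) (w.1.adicCompletion L))) * k : GL (Fin 2) (w.1.adicCompletion L)) : Matrix (Fin 2) (Fin 2) (w.1.adicCompletion L)) - 1)).restrictScalars (Valued.integer (w.1.adicCompletion L))) ≤ scaleLattice (ϖ ^ m) B} := by
    refine ⟨?_, (mapGL_stdLattice_eq_iff _).2 ⟨hBint, hBinv⟩, ?_⟩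
    · rw [← stdForm_antidiagonal_two_over_eq]; exact isSelfDualLattice_stdLattice_two_of_v hϖ
    · have h := map_sub_one_latt_le_scaleLattice_iff (pow_ne_zero m hϖ0) (k⁻¹ * (Matrix.GeneralLinearGroup.scalar (Fin 2) s * ((localNonsplitEquiv (IsCMField.complexConj L) (Matrix.of fun i j : Fin 2 => if i.val + j.val + 1 = 2 then (1 : L) else 0) (IsCMField.complexConj_ne_one L) w hw γH.1).val : GL (Fin 2) (w.1.adicCompletion L))) * k : GL (Fin 2) (w.1.adicCompletion L)) 1
      rw [Units.val_one, latt_one, inv_one, one_mul, mul_one] at h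
      exact h.2 fun i j => by rw [map_pow]; exact hd i j
  have hWtop : {B : Submodule (Valued.integer (w.1.adicCompletion L)) (Fin 2 → (w.1.adicCompletion L)) |
        IsSelfDualLattice (galAdicCompletionMap (L := L) (IsCMField.complexConj L) hw) ϖ (!![(0 : w.1.adicCompletion L), 1; 1, 0] : Matrix (Fin 2) (Fin 2) (w.1.adicCompletion L)) B ∧
        mapGL (k⁻¹ * (Matrix.GeneralLinearGroup.scalar (Fin 2) s * ((localNonsplitEquiv (IsCMField.complexConj L) (Matrix.of fun i j : Fin 2 => if i.val + j.val + 1 = 2 then (1 : L) else 0) (IsCMField.complexConj_ne_one L) w hw γH.1).val : GL (Fin 2) (w.1.adicCompletion L))) * k : GL (Fin 2) (w.1.adicCompletion L)) B = B ∧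
        B.map ((Matrix.toLin' (((k⁻¹ * (Matrix.GeneralLinearGroup.scalar (Fin 2) s * ((localNonsplitEquiv (IsCMField.complexConj L) (Matrix.of fun i j : Fin 2 => if i.val + j.val + 1 = 2 then (1 : L) else 0) (IsCMField.complexConj_ne_one L) w hw γH.1).val : GL (Fin 2) (w.1.adicCompletion L))) * k : GL (Fin 2) (w.1.adicCompletion L)) : Matrix (Fin 2) (Fin 2) (w.1.adicCompletion L)) - 1)).restrictScalars (Valued.integer (w.1.adicCompletion L))) ≤ scaleLattice (ϖ ^ m) B} = {stdLattice (w.1.adicCompletion L) 2} := by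
    obtain ⟨B, hB⟩ := Set.ncard_eq_one.1 hW1
    rw [hB] at hstd ⊢
    rw [Set.mem_singleton_iff.1 hstd]
  -- the residual data of `B₀` and the non-square token `ε := 4·Y₀₁Y₁₀`
  have hdiag := v_leading_diag_sub_lt_one hvσ hσϖ hϖ hres hU hmodd Y hY
  have h4 := forall_v_sq_sub_four_mul_eq_one h2v hsq hϖ hirr' hdisc' Y hY hdiag
  have hεv : Valued.v (4 * (((Y 0 1 : Valued.integer (w.1.adicCompletion L)) : (w.1.adicCompletion L)) * ((Y 1 0 : Valued.integer (w.1.adicCompletion L)) : (w.1.adicCompletion L)))) = 1 := by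
    have h := h4 0 (by rw [map_zero]; exact zero_le_one)
    rwa [zero_pow two_ne_zero, zero_sub, Valuation.map_neg] at h
  -- THE ROOT CENSUS (this seat) and THE TOTAL (★ p849287)
  obtain ⟨hsR, νE, νP, νM, hNE, hNP, hNM, hsum, hfav, hunf⟩ := rootRegionCensus_hyperbolic_odd hσσ hvσ hσϖ hϖ hres h2v hT hγ'0 (k⁻¹ * (Matrix.GeneralLinearGroup.scalar (Fin 2) s * ((localNonsplitEquiv (IsCMField.complexConj L) (Matrix.of fun i j : Fin 2 => if i.val + j.val + 1 = 2 then (1 : L) else 0) (IsCMField.complexConj_ne_one L) w hw γH.1).val : GL (Fin 2) (w.1.adicCompletion L))) * k : GL (Fin 2) (w.1.adicCompletion L)) hγ' hm3 hmodd hsq hU hirr' hdisc' Y hY hd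
    hWtop 1 _ (map_one _) hεv h4
  have htot := hyperbolicTotal_zero_ram_of_region_census_odd L w hw he h2 ϖ hϖ hσϖ γH hu2 hirr m mA hmA s hs k hk hd γ' hγ' 1 _ (map_one _) hεv h4 _ hsR _ _ _ hNE hNP hNM
  -- THE SIGN: `χ(det Ȳ_W) = (β, θ)_v` via `det(B₀ − 1) = s²·(χ_g(u))_w`
  have hsv : Valued.v (s : (w.1.adicCompletion L)) = 1 := by
    have h := congrArg Valued.v hs
    rwa [map_mul, v_oneByOne_eq_one_of_local L w hw γH.2, mul_one, map_one] at h
  have hq := eval_finCharpolyTwo_finGammaTwo_apply_eq_quadratic L v w γH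
  have hev : (((localNonsplitEquiv (IsCMField.complexConj L) (Matrix.of fun i j : Fin 2 => if i.val + j.val + 1 = 2 then (1 : L) else 0) (IsCMField.complexConj_ne_one L) w hw γH.1).val : GL (Fin 2) (w.1.adicCompletion L)) : Matrix (Fin 2) (Fin 2) (w.1.adicCompletion L)).charpoly.eval ((((localNonsplitEquiv (IsCMField.complexConj L) (Matrix.of fun i j : Fin 1 => if i.val + j.val + 1 = 1 then (1 : L) else 0) (IsCMField.complexConj_ne_one L) w hw γH.2).val : GL (Fin 1) (w.1.adicCompletion L)) : Matrix (Fin 1) (Fin 1) (w.1.adicCompletion L)) 0 0) = ((finCharpolyTwo L v γH).eval (finGammaTwo L v γH)) w := by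
    rw [coe_localNonsplitEquiv_apply, coe_localNonsplitEquiv_apply, hq, eval_charpoly_fin_two_eq_det_sub_smul_one, Matrix.det_fin_two, Matrix.trace_fin_two,
      Matrix.det_fin_two]
    simp only [Matrix.sub_apply, Matrix.smul_apply, Matrix.map_apply, Matrix.one_apply_eq, ne_eq, zero_ne_one, not_false_eq_true, Matrix.one_apply_ne, one_ne_zero,
      smul_eq_mul, mul_one, mul_zero, sub_zero, Pi.evalRingHom_apply, finGammaTwo]
    ring
  have hdetB : (((k⁻¹ * (Matrix.GeneralLinearGroup.scalar (Fin 2) s * ((localNonsplitEquiv (IsCMField.complexConj L) (Matrix.of fun i j : Fin 2 => if i.val + j.val + 1 = 2 then (1 : L) else 0) (IsCMField.complexConj_ne_one L) w hw γH.1).val : GL (Fin 2) (w.1.adicCompletion L))) * k : GL (Fin 2) (w.1.adicCompletion L)) : Matrix (Fin 2) (Fin 2) (w.1.adicCompletion L)) - 1).det = (s : (w.1.adicCompletion L)) ^ 2 * ((finCharpolyTwo L v γH).eval (finGammaTwo L v γH)) w := by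
    rw [det_coe_inv_conj_scalar_mul_sub_one k _ s rfl hs, ← eval_charpoly_fin_two_eq_det_sub_smul_one, hev]
  have hpm0 : (ϖ ^ m : (w.1.adicCompletion L)) ≠ 0 := pow_ne_zero _ hϖ0
  have hYdet : (((Y 0 0 * Y 1 1 - Y 0 1 * Y 1 0 : Valued.integer (w.1.adicCompletion L)) : Valued.integer (w.1.adicCompletion L)) : (w.1.adicCompletion L)) =
      (s : (w.1.adicCompletion L)) ^ 2 * (((finCharpolyTwo L v γH).eval (finGammaTwo L v γH)) w / ϖ ^ (2 * m)) := by
    have e : (((Y 0 0 * Y 1 1 - Y 0 1 * Y 1 0 : Valued.integer (w.1.adicCompletion L)) : Valued.integer (w.1.adicCompletion L)) : (w.1.adicCompletion L)) =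
        ((ϖ ^ m)⁻¹) ^ 2 * (((k⁻¹ * (Matrix.GeneralLinearGroup.scalar (Fin 2) s * ((localNonsplitEquiv (IsCMField.complexConj L) (Matrix.of fun i j : Fin 2 => if i.val + j.val + 1 = 2 then (1 : L) else 0) (IsCMField.complexConj_ne_one L) w hw γH.1).val : GL (Fin 2) (w.1.adicCompletion L))) * k : GL (Fin 2) (w.1.adicCompletion L)) : Matrix (Fin 2) (Fin 2) (w.1.adicCompletion L)) - 1).det := by
      simp only [AddSubgroupClass.coe_sub, MulMemClass.coe_mul, hY, Matrix.det_fin_two]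
      ring
    rw [e, hdetB, pow_mul, ← inv_pow]
    ring
  have hvdet : Valued.v ((((Y 0 0 * Y 1 1 - Y 0 1 * Y 1 0 : Valued.integer (w.1.adicCompletion L)) : Valued.integer (w.1.adicCompletion L)) : (w.1.adicCompletion L))) = 1 := by
    have e : (((Y 0 0 * Y 1 1 - Y 0 1 * Y 1 0 : Valued.integer (w.1.adicCompletion L)) : Valued.integer (w.1.adicCompletion L)) : (w.1.adicCompletion L)) =
        ((ϖ ^ m)⁻¹) ^ 2 * (((k⁻¹ * (Matrix.GeneralLinearGroup.scalar (Fin 2) s * ((localNonsplitEquiv (IsCMField.complexConj L) (Matrix.of fun i j : Fin 2 => if i.val + j.val + 1 = 2 then (1 : L) else 0) (IsCMField.complexConj_ne_one L) w hw γH.1).val : GL (Fin 2) (w.1.adicCompletion L))) * k : GL (Fin 2) (w.1.adicCompletion L)) : Matrix (Fin 2) (Fin 2) (w.1.adicCompletion L)) - 1).det := by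
      simp only [AddSubgroupClass.coe_sub, MulMemClass.coe_mul, hY, Matrix.det_fin_two]
      ring
    rw [e, Valuation.map_mul, map_pow, map_inv₀, v_det_rerootedCentred_sub_one_eq_ram L w hw he ϖ hϖ γH m hm s hs k, map_pow, inv_pow, ← pow_mul, mul_comm m 2,
      inv_mul_cancel₀ (pow_ne_zero _ ((Valuation.ne_zero_iff _).2 hϖ0))]
  have hres0 : IsLocalRing.residue (Valued.integer (w.1.adicCompletion L)) (Y 0 0 * Y 1 1 - Y 0 1 * Y 1 0) ≠ 0 := fun h => by
    rw [residue_eq_zero_iff_v_lt_one, hvdet] at h; exact lt_irrefl _ h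
  have hs0r : IsLocalRing.residue (Valued.integer (w.1.adicCompletion L)) ⟨(s : (w.1.adicCompletion L)), hsv.le⟩ ≠ 0 := fun h => by
    rw [residue_eq_zero_iff_v_lt_one] at h; exact (ne_of_lt h) hsv
  have hHS1 := typeTwo_hilbertSymbol_eq_one_iff_exists_sq_ram L w hw he h2 ϖ hϖ hσϖ hblk hu2 hmodd hm β hβ
  have hbridge : (∃ z : w.1.adicCompletion L, Valued.v z = 1 ∧ Valued.v (((finCharpolyTwo L v γH).eval (finGammaTwo L v γH)) w / ϖ ^ (2 * m) - z ^ 2) < 1) ↔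
      quadraticChar (Valued.ResidueField (w.1.adicCompletion L)) (IsLocalRing.residue (Valued.integer (w.1.adicCompletion L)) (Y 0 0 * Y 1 1 - Y 0 1 * Y 1 0)) = 1 := by
    have key := exists_unit_v_sub_mul_sq_lt_one_iff_residue (Y 0 0 * Y 1 1 - Y 0 1 * Y 1 0) (⟨(s : (w.1.adicCompletion L)), hsv.le⟩ ^ 2)
    have hs2 : Valued.v ((s : (w.1.adicCompletion L)) ^ 2) = 1 := by rw [map_pow, hsv, one_pow]
    have step1 : (∃ z : w.1.adicCompletion L, Valued.v z = 1 ∧ Valued.v (((finCharpolyTwo L v γH).eval (finGammaTwo L v γH)) w / ϖ ^ (2 * m) - z ^ 2) < 1) ↔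
        ∃ a₀ : w.1.adicCompletion L, Valued.v a₀ = 1 ∧ Valued.v ((((Y 0 0 * Y 1 1 - Y 0 1 * Y 1 0 : Valued.integer (w.1.adicCompletion L)) : Valued.integer (w.1.adicCompletion L)) : (w.1.adicCompletion L)) -
          (((⟨(s : (w.1.adicCompletion L)), hsv.le⟩ ^ 2 : Valued.integer (w.1.adicCompletion L)) : Valued.integer (w.1.adicCompletion L)) : (w.1.adicCompletion L)) * a₀ ^ 2) < 1 := by
      refine exists_congr fun z => and_congr_right fun _ => ?_
      rw [hYdet, show (((⟨(s : (w.1.adicCompletion L)), hsv.le⟩ ^ 2 : Valued.integer (w.1.adicCompletion L)) : Valued.integer (w.1.adicCompletion L)) : (w.1.adicCompletion L)) =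
        (s : (w.1.adicCompletion L)) ^ 2 by push_cast; rfl, ← mul_sub, Valuation.map_mul, hs2, one_mul]
    rw [step1, key]
    have step2 : (∃ a : Valued.ResidueField (w.1.adicCompletion L), a ≠ 0 ∧ IsLocalRing.residue (Valued.integer (w.1.adicCompletion L)) (Y 0 0 * Y 1 1 - Y 0 1 * Y 1 0) =
        IsLocalRing.residue (Valued.integer (w.1.adicCompletion L)) (⟨(s : (w.1.adicCompletion L)), hsv.le⟩ ^ 2) * a ^ 2) ↔
        ∃ b : Valued.ResidueField (w.1.adicCompletion L), b ≠ 0 ∧ IsLocalRing.residue (Valued.integer (w.1.adicCompletion L)) (Y 0 0 * Y 1 1 - Y 0 1 * Y 1 0) = 1 * b ^ 2 := by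
      constructor
      · rintro ⟨a, ha, h⟩
        exact ⟨IsLocalRing.residue (Valued.integer (w.1.adicCompletion L)) ⟨(s : (w.1.adicCompletion L)), hsv.le⟩ * a, mul_ne_zero hs0r ha, by rw [h, map_pow]; ring⟩
      · rintro ⟨b, hb, h⟩
        refine ⟨(IsLocalRing.residue (Valued.integer (w.1.adicCompletion L)) ⟨(s : (w.1.adicCompletion L)), hsv.le⟩)⁻¹ * b, mul_ne_zero (inv_ne_zero hs0r) hb, ?_⟩
        rw [h, map_pow]; field_simp
    rw [step2, exists_ne_zero_eq_mul_sq_iff_quadraticChar one_ne_zero, inv_one, one_mul]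
  refine ⟨Nat.card (Valued.ResidueField (w.1.adicCompletion L)) * νE, Nat.card (Valued.ResidueField (w.1.adicCompletion L)) * (νP + νM), ?_, ?_, ?_⟩
  · rw [htot, Finset.card_singleton]; push_cast; ring
  · intro hH
    have hχ1 := hbridge.1 (hHS1.1 hH)
    have hE2 : νE = 2 := hfav hχ1
    refine ⟨?_, ?_⟩
    · push_cast; rw [hqN, hE2]; push_cast; ring
    · push_cast; rw [hqN]
      have h := congrArg (fun t : ℕ => (t : ℂ)) hsum
      have h2' : (νE : ℂ) = 2 := by exact_mod_cast hE2
      push_cast at h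
      rw [hqN] at h
      linear_combination (Ideal.absNorm v.asIdeal : ℂ) * h - (Ideal.absNorm v.asIdeal : ℂ) * h2'
  · intro hH
    have hne : ¬ hilbertSymbol (v.adicCompletion ↥(maximalRealSubfield L)) (β : v.adicCompletion ↥(maximalRealSubfield L))
        (algebraMap ↥(maximalRealSubfield L) _ ((cmQuadraticGenerator L : 𝓞 ↥(maximalRealSubfield L)) : ↥(maximalRealSubfield L))) = 1 := by
      rw [hH]; norm_num
    have hχ : quadraticChar (Valued.ResidueField (w.1.adicCompletion L)) (IsLocalRing.residue (Valued.integer (w.1.adicCompletion L)) (Y 0 0 * Y 1 1 - Y 0 1 * Y 1 0)) = -1 :=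
      (quadraticChar_eq_neg_one_iff_not_one hres0).2 fun h1 => hne (hHS1.2 (hbridge.2 h1))
    have hE0 : νE = 0 := hunf hχ
    refine ⟨?_, ?_⟩
    · push_cast; rw [hE0]; push_cast; ring
    · push_cast; rw [hqN]
      have h := congrArg (fun t : ℕ => (t : ℂ)) hsum
      have h0' : (νE : ℂ) = 0 := by exact_mod_cast hE0
      push_cast at h
      rw [hqN] at h
      linear_combination (Ideal.absNorm v.asIdeal : ℂ) * h - (Ideal.absNorm v.asIdeal : ℂ) * h0'

end Literature.NumberTheory.Rogawski1990.BlockLawHyp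

end
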